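import Summits.QuantumFields.YangMills.Theses.LogConcaveChart

/-!
# Route `LogConcaveChart` — glue of the TRANSPORT SPLIT of `QuadraticCovarianceComparison`
(item stmt-QuantumFields-23669 `TransportSplitGlue`, split gen 1 filed by ideator seat ym-idea-8 g8)

`TransportSplitGlue : SandwichTransportMap → TransportCovarianceTransfer → QuadraticCovarianceComparison`.

Bookkeeping only: take the universal constant `C` of `TransportCovarianceTransfer` and `δ₀ := 1/2`;
at admissible data `(δ, n, H₀, H_f, H_g, b_f, b_g, A)` the transport chart `SandwichTransportMap`
(hypotheses `H₀ ≻ 0`, `A` continuous, Hessian sandwich) yields a `C¹` map `T` pushing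
`N(0, H₀⁻¹)` to `e^{-A}dx/Z` with `T − id` `δ`-Lipschitz in the `H₀`-metric, and the transfer
applied to `T` (with the centring hypothesis) is the let-bound conclusion of
`QuadraticCovarianceComparison` verbatim.

HONEST SCOPE. This closes only the glue item of the split; the two children
(`SandwichTransportMap`: Caffarelli–Kolesnikov two-sided contraction, a theorem in print;
`TransportCovarianceTransfer`: provable from the tree's Gaussian toolbox) remain open, and nothing
here proves `QuadraticCovarianceComparison`, the `LogConcaveChart` thesis, rung R2a
(`BalabanLadder.NT`) or any summit statement; the Yang–Mills mass gap is NOT proved.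
-/

namespace Summit.QuantumFields.YangMills.Theorems

open Summit.QuantumFields.YangMills.Theses.LogConcaveChart in
/-- **Glue of the transport split** (item stmt-QuantumFields-23669): modus ponens through the
transport map. [folklore] -/
theorem logConcaveChart_transportSplitGlue :
    Summit.QuantumFields.YangMills.Theses.LogConcaveChart.TransportSplitGlue := by
  intro h1 h2
  obtain ⟨C, hC⟩ := h2
  refine ⟨C, 1 / 2, by norm_num, by norm_num, ?_⟩
  intro δ hδ0 hδ1 n H₀ Hf Hg bf bg A hH hf hg hA hsw hc
  obtain ⟨T, hT1, hT2, hT3, hT4⟩ := h1 δ hδ0 hδ1 n H₀ A hH hA hsw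
  exact hC δ hδ0 hδ1 n H₀ Hf Hg bf bg A T hH hf hg hc hT1 hT2 hT3 hT4

end Summit.QuantumFields.YangMills.Theorems
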